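import Literature.NumberTheory.EllipticCurves.Sprung2024.ChromaticLocalInjectivityProofs
import Literature.NumberTheory.EllipticCurves.Sprung2012.ColemanMapSurjectiveProofs
import HarnessLib

/-!
# Sprung 2024, §5.2: Lemma 5.5 (case `v = p`, "`r_p` is injective") and Lemma 5.6 (corollary form,
# finite Selmer ⟹ finite coinvariants) are UNCONDITIONAL — discharge of four named facts (proofs only)

Topic `Literature/NumberTheory/EllipticCurves`, cluster `Sprung2024` (namespace = path). A THEOREMS
file (no definition, no named fact; net Literature debt `−4`), cell `pub/bsd-cited` (ARM P
referee-reader seat `bsd-cited-r18`, base role), downstream of the two proof files it imports: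

* `ChromaticLocalInjectivityProofs.lean` (cell `bsd-ssimc`, seat `kdot-split` g6) proved F. Sprung,
  Adv. Math. **449** (2024) 109741 [Sprung2024], §5.2, proof of Lemma 5.5, case `v = p` (p. 40: "We
  want to show that the map `H¹(ℚ_p, E[p^∞])/E(ℚ_p) ⊗ ℚ_p/ℤ_p ⟶(r_p) H¹(ℚ_{p,∞}, E[p^∞])/E⋆_{∞,p}` is
  injective … Taking Pontryagin duals, we see that `r_p` is injective, as claimed") MODULO its three
  Sprung 2012 inputs — `lem55AllN_of_colemanSurjective : prop73_… → prop76_… → lem23_… → lem55AllN_…`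
  and `lem55_of_colemanSurjective`;
* `Sprung2012/ColemanMapSurjectiveProofs.lean` and `Sprung2012/LocalTowerNoPTorsionProofs.lean`
  (this seat) discharged those inputs: F. E. I. Sprung, J. Number Theory 132 (2012) [Sprung2012],
  Prop. 7.3 (p. 1500: "`Col♭` is surjective"), Prop. 7.6 first sentence (p. 1501: "If `η` is trivial,
  then `ε_η Col♯` is surjective") and Lemma 2.3 (p. 1487: "`F_ss(k_n)` has no `p`-torsion") —
  `prop73_colemanFlat_surjective_holds`, `prop76_colemanSharp_surjective_holds`,
  `lem23_localTowerPoints_noPTorsion_holds`.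

Hence (§1) `lem55AllN_sharpFlat_localKerOver_of_layerToInfty_mem_holds` and
`lem55_sharpFlat_localKerOver_of_layerToInfty_mem_holds` (the named facts of
`ChromaticLocalInjectivity.lean`), and (§2) — by the kernel theorem
`finite_sharpFlat_coinvariants_of_finite_selmer_of_sharpFlatLocalKummer_rat` of
`ChromaticSmallControlProofs.lean` (cell `bsd-ssimc`), which derives Lemma 5.6 (p. 41, Small Control,
corollary form "`Sel(E/ℚ)` finite ⟹ `X⋆/TX⋆` finite") from the `v = p` clause —
`lem56AllN_sharpFlat_finite_coinvariants_of_finite_selmer_holds` and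
`lem56_sharpFlat_finite_coinvariants_of_finite_selmer_holds` (the named facts of
`ChromaticSmallControl.lean`; the converse-direction facts `lem56[AllN]_sharpFlat_finite_selmer_of_finite_coinvariants`
were already discharged in `ChromaticSmallControlSurjProofs.lean`). The §2 terms are the bodies of the
summit-side `lem56AllN_of_lem55AllN` / `lem56_of_lem55` (`Summits/…/SignedLowerHalvesSprungLowerHalfAtThreeSplitConverseLocal.lean`,
which a Literature file may not import) with `h55` fed by §1. A separate file because
`ChromaticSmallControlProofs.lean` is upstream of `ColemanMapSurjectiveProofs.lean` (no import cycle).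
HONEST FRAMING: four trust-base inputs of route K3's crux-5 roads become kernel theorems; no
statement about any curve, no census cell, BSD is not advanced beyond that.

## References
* [Sprung2024] F. Sprung, Adv. Math. 449 (2024) 109741, §5.2: Lemma 5.5 and its proof, case `v = p`
  (p. 40); Lemma 5.6 (p. 41).
* [Sprung2012] F. E. I. Sprung, J. Number Theory 132 (2012): Lemma 2.3 (p. 1487), Prop. 7.3 (p. 1500),
  Prop. 7.6 (p. 1501).
* [Kobayashi2003] S. Kobayashi, Invent. Math. 152 (2003), Thm. 9.3; [GreenbergLNM1716] §3 Lemmas 3.2–3.3.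
-/

noncomputable section

open scoped Classical NumberField

open NumberField IsDedekindDomain

namespace Literature.NumberTheory.EllipticCurves.Sprung2024

open Literature.NumberTheory.EllipticCurves Literature.NumberTheory.GaloisRepresentations
  WeierstrassCurve ZpExtension Literature.NumberTheory.EllipticCurves.Kobayashi2003
  Literature.NumberTheory.EllipticCurves.Sprung2017 Literature.NumberTheory.EllipticCurves.Sprung2012

/-! ## §1 Lemma 5.5, case `v = p`: "`r_p` is injective" — unconditional -/

/-- **DISCHARGE of `lem55AllN_sharpFlat_localKerOver_of_layerToInfty_mem`** (the every-conductor form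
of Sprung 2024 Lemma 5.5, case `v = p`): `lem55AllN_of_colemanSurjective` fed with the tree's
discharges of Sprung 2012 Prop. 7.3, Prop. 7.6 (`η = 1`) and Lemma 2.3.
[cite: Sprung2024, §5.2 proof of Lemma 5.5, case v = p (p. 40)]
[cite: Sprung2012, Prop. 7.3 (p. 1500), Prop. 7.6 (p. 1501), Lemma 2.3 (p. 1487)] -/
theorem lem55AllN_sharpFlat_localKerOver_of_layerToInfty_mem_holds :
    lem55AllN_sharpFlat_localKerOver_of_layerToInfty_mem :=
  lem55AllN_of_colemanSurjective prop73_colemanFlat_surjective_holds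
    prop76_colemanSharp_surjective_holds lem23_localTowerPoints_noPTorsion_holds

/-- **DISCHARGE of `lem55_sharpFlat_localKerOver_of_layerToInfty_mem`** (Sprung 2024 Lemma 5.5 as
printed — square-free conductor — case `v = p`: "`r_p` is injective").
[cite: Sprung2024, Lemma 5.5 and §5.2 proof, case v = p (p. 40)]
[cite: Sprung2012, Prop. 7.3 (p. 1500), Prop. 7.6 (p. 1501), Lemma 2.3 (p. 1487)] -/
theorem lem55_sharpFlat_localKerOver_of_layerToInfty_mem_holds :
    lem55_sharpFlat_localKerOver_of_layerToInfty_mem :=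
  lem55_of_colemanSurjective prop73_colemanFlat_surjective_holds
    prop76_colemanSharp_surjective_holds lem23_localTowerPoints_noPTorsion_holds

/-! ## §2 Lemma 5.6, corollary form: `Sel(E/ℚ)` finite ⟹ `X⋆/TX⋆` finite — unconditional -/

/-- **DISCHARGE of `lem56AllN_sharpFlat_finite_coinvariants_of_finite_selmer`** (the every-conductor
form of Sprung 2024 Lemma 5.6, Small Control, corollary form): the kernel theorem
`finite_sharpFlat_coinvariants_of_finite_selmer_of_sharpFlatLocalKummer_rat` (Pontryagin duality for
`X⋆`, Greenberg's Lemmas 3.2–3.3 at `n = 0`; file `ChromaticSmallControlProofs.lean`) with its one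
supersingular input, the `v = p` clause of Lemma 5.5, now a theorem (§1). The binders `p ≠ 2`, good
reduction, `p ∣ a_p`, `κ` cyclotomic, `IsCyclotomicVariable`, the Honda relations are only passed
through. [cite: Sprung2024, §5.2 Lemma 5.6 (p. 41) and proof of Lemma 5.5 (p. 40)]
[cite: Kobayashi2003, Thm. 9.3] [cite: GreenbergLNM1716, §3 Lemmas 3.2–3.3] -/
theorem lem56AllN_sharpFlat_finite_coinvariants_of_finite_selmer_holds :
    lem56AllN_sharpFlat_finite_coinvariants_of_finite_selmer := by
  intro W _ _ p _ hp2 hgood hap κ γ hκ hγ _hX v hv g hg cneg c hH col D hfin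
  exact finite_sharpFlat_coinvariants_of_finite_selmer_of_sharpFlatLocalKummer_rat W p κ hγ v hv g c
    col D (lem55AllN_sharpFlat_localKerOver_of_layerToInfty_mem_holds W p hp2 hgood hap κ hκ v hv g hg
      cneg c hH col) hfin

/-- **DISCHARGE of `lem56_sharpFlat_finite_coinvariants_of_finite_selmer`** (Sprung 2024 Lemma 5.6 as
printed — square-free conductor — Small Control, corollary form).
[cite: Sprung2024, §5.2 Lemma 5.6 (p. 41) and proof of Lemma 5.5 (p. 40)]
[cite: Kobayashi2003, Thm. 9.3] [cite: GreenbergLNM1716, §3 Lemmas 3.2–3.3] -/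
theorem lem56_sharpFlat_finite_coinvariants_of_finite_selmer_holds :
    lem56_sharpFlat_finite_coinvariants_of_finite_selmer := by
  intro W _ _ p _ hp2 hss hgood hap κ γ hκ hγ _hX v hv g hg cneg c hH col D hfin
  exact finite_sharpFlat_coinvariants_of_finite_selmer_of_sharpFlatLocalKummer_rat W p κ hγ v hv g c
    col D (lem55_sharpFlat_localKerOver_of_layerToInfty_mem_holds W p hp2 hss hgood hap κ hκ v hv g hg
      cneg c hH col) hfin

end Literature.NumberTheory.EllipticCurves.Sprung2024

end
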